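import Summits.BirchSwinnertonDyer.BirchSwinnertonDyer.Theorems.KimAtThreeDeepLowerDeepPortWith
import Summits.BirchSwinnertonDyer.BirchSwinnertonDyer.Theorems.KimAtThreeDeepLowerS24DeepOrderOfPinned
import Summits.BirchSwinnertonDyer.BirchSwinnertonDyer.Theorems.KimAtThreeShallowEqDeepGoodCoreVertexRat
import Summits.BirchSwinnertonDyer.Rank1Residual.GaloisImage.KuriharaTowerPackaging
import HarnessLib

/-!
# Route `KimAtThreeKolyvagin` (rung W2): the shared-`η` DEEP family of Kolyvagin data with generators and
# [S24] Thm. 4.4 (1)(2) at every depth FROM THE PINNED LITERATURE FACTS — no S24-DEEP port, no extra input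

Cell `bsd-addord`, seat `bsd-addord-w2-c2` (gen 6; `--supports stmt-BirchSwinnertonDyer-19075`).  Executes the
gen-5 successor items (i)/(ii) of this seat (HANDOFF § w2-c2 session 5): the consumers of the flagged ports
S24-DEEP (1)(2) (`GaloisImage.S24Deep.kolyvaginSystems_freeRankOne_zmod_three_pow_deep` / `…idealOfBasis…_deep`,
FLAG `S24-DEEP-PORT@3`) obtain their deep generators through this seat's gen-0
`KimAtThreeDeepLowerDeepPortWith.exists_deepFamily_of_towerSurj_with`; here is its DROP-IN with the ports
replaced by Sakamoto 2024 Thm. 4.4 (1)(2) AS PRINTED (`Sakamoto2024.kolyvaginSystems_freeRankOne_zmod_three_pow`,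
`…idealOfBasis_eq_fittingIdeal_zmod_three_pow`, PUB, pinned) and NOTHING ELSE: the good core vertex that gen 5's
`KimAtThreeDeepLowerS24DeepOrderOfPinned.exists_generator_kolyvaginSystems_deep_of_pinned` demands is PRODUCED,
row-free and port-free, by w2-c4's `exists_superset_kummerSelmerGroup_eq_bot_rat_three_deep` on the `E[3]`-datum
of the deep class (the `3`-descent Selmer group is finite, `finite_selmerGroup_holds`; the pattern of w2-c5 gen 3's
`KimAtThreeStubOfPinned.kolyvaginSystems_freeRankOne_deep_of_pinned_of_towerSurj`, here for the full generator
package with the order relations).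

HONEST FRAMING. TOOL theorems only (no definition, no named fact, no `sorry`); nothing asserted about any curve,
nothing booked; closes nothing by itself; BSD is not proved by any of this.  CONDITIONAL on the two PUBLISHED
pinned facts only (by hypothesis).

* §1 `exists_generator_kolyvaginSystems_deep_of_pinned_of_towerSurj` — n1011's
  `SakamotoN11InstanceDeepTower.exists_generator_kolyvaginSystems_deep_of_towerSurj` (ONE basis `κ` of
  `KS₁(E[3^k·3], 𝓕_can, 𝒫′)` on the deep class `𝒫′` through `E[3^{k′}·3]`, additive order `3^{k+1}`,
  ℕ-generating, [S24] (2) in ORDER form at every level for every full-level Poitou–Tate family) with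
  `hS24d hS24d₂ ↦ hS24 hS24₂` and `1 ≤ k`; binders otherwise verbatim.
* §2 **`exists_deepFamily_of_pinned_with`** — gen 0's `exists_deepFamily_of_towerSurj_with` (every `∀ k′` deep
  binder of the END theorems at once, ONE shared `η`) from `hS24 hS24₂`, for a certificate depth `k ≥ 1` and a
  class shift `N`: the member at depth `k′ ≥ 1` lies on the deep class of exponent `max k k′ + N`, the member at
  depth `0` on the pinned class (exponent `0`; n1011's pinned `TowerPackage.exists_generator_kolyvaginSystems_of_towerSurj`,
  so that no `k = 0` deep slice is needed); nesting `(D k′).primes ⊆ (D k).primes` for `k ≤ k′`, primes off `S`,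
  Rubin's local shape, generators, orders, ℕ-generation and the order relations at every depth.
References: [Sakamoto2024] Thm. 4.4 (1)(2) (p. 926), Lemma 5.2; [MazurRubin2004] §3.5 (H.5), Thm. 4.4.1, Cor. 4.5.2
(iv), Prop. A.2; [Rubin2011] Def. 1.9.6, 2.1.3; [SilvermanAEC2009] Thm. X.4.2 (b).
-/

set_option autoImplicit false
-- the Theorems namespace of a single-conjunct summit repeats the summit name by design (D-0017)
set_option linter.dupNamespace false

noncomputable section

open scoped Classical NumberField ContRepresentation
open Function Field NumberField IsDedekindDomain IsDedekindDomain.HeightOneSpectrum WeierstrassCurve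
  Literature.NumberTheory.EllipticCurves Literature.NumberTheory.EllipticCurves.Rank1Residual
  Literature.NumberTheory.GaloisRepresentations
  Literature.NumberTheory.GaloisRepresentations.DiscreteGaloisModule Literature.NumberTheory.GaloisCohomology
  Literature.NumberTheory.GaloisCohomology.KolyvaginDatum
  Summit.BirchSwinnertonDyer.Rank1Residual.GaloisImage
  Summit.BirchSwinnertonDyer.Rank1Residual.GaloisImage.Transport
  Summit.BirchSwinnertonDyer.Rank1Residual.GaloisImage.S24Deep

namespace Summit.BirchSwinnertonDyer.BirchSwinnertonDyer.Theorems.KimAtThreeDeepLowerDeepFamilyOfPinned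

open Summit.BirchSwinnertonDyer.BirchSwinnertonDyer.Theorems.KimAtThreeDeepLowerS24DeepTower
  Summit.BirchSwinnertonDyer.BirchSwinnertonDyer.Theorems.KimAtThreeDeepLowerS24DeepOfPinned
  Summit.BirchSwinnertonDyer.BirchSwinnertonDyer.Theorems.KimAtThreeDeepLowerS24DeepOrderOfPinned
  Summit.BirchSwinnertonDyer.BirchSwinnertonDyer.Theorems.KimAtThreeShallowEqDeepGoodCoreVertex
  Summit.BirchSwinnertonDyer.BirchSwinnertonDyer.Theorems.KimAtThreeDeepLowerDeepPortWith

/-! ### §1 The deep generator package from the PINNED facts, the good core vertex produced -/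

/-- **n1011's `exists_generator_kolyvaginSystems_deep_of_towerSurj` FROM THE PINNED [S24] Thm. 4.4 (1)(2)**
(`1 ≤ k ≤ k′`): for a tower-surjective `W`, `τ ∈ Γ_{ℚ(μ_{3^{k′+1}})}` with `E[3^{k′}·3]/(τ − 1) ≃ ℤ/3^{k′+1}`,
a Poitou–Tate family at `3`, Tate's local Euler–Poincaré characteristic, `S ⊇ ∞ ∪ {3} ∪ {bad}` and a Kolyvagin
datum `D` of `E[3^k·3]` on THE deep class `frobeniusClassPrimes (E[3^{k′}·3]) S τ 3^{k′+1}` with cyclotomic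
transverse conditions and canonical comparison for `η`: ONE basis `κ` of `KS₁(E[3^k·3], 𝓕_can, 𝒫′)` of additive
order `3^{k+1}`, ℕ-generating, with [S24] Thm. 4.4 (2) in ORDER form at every level.  Proof: the good core vertex
of gen 5's `…OrderOfPinned.exists_generator_kolyvaginSystems_deep_of_pinned` is produced on the `E[3]`-datum of the
deep class (`exists_deepDatum_torsion_three`) by `exists_superset_kummerSelmerGroup_eq_bot_rat_three_deep`
(`Sel^{(3)}(E/ℚ)` finite), exactly as in w2-c5's `kolyvaginSystems_freeRankOne_deep_of_pinned_of_towerSurj`.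
[cite: Sakamoto2024, Thm. 4.4 (1)(2) (p. 926)] [cite: MazurRubin2004, §3.5 (H.5) (p. 27) and Cor. 4.5.2 (iv) (p. 48)]
[cite: SilvermanAEC2009, Thm X.4.2(b)] -/
theorem exists_generator_kolyvaginSystems_deep_of_pinned_of_towerSurj
    (hS24 : Sakamoto2024.kolyvaginSystems_freeRankOne_zmod_three_pow)
    (hS24₂ : Sakamoto2024.kolyvaginSystems_idealOfBasis_eq_fittingIdeal_zmod_three_pow)
    (W : WeierstrassCurve ℚ) [W.IsElliptic] {k k' : ℕ} (hk : 1 ≤ k) (hkk' : k ≤ k')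
    [Finite (geomTorsion W ((3 : ℕ) : ℤ))] [Finite (geomTorsion W (((3 : ℕ) : ℤ) ^ k * ((3 : ℕ) : ℤ)))]
    [Finite (geomTorsion W (((3 : ℕ) : ℤ) ^ k' * ((3 : ℕ) : ℤ)))]
    (htower : ∀ n : ℕ, W.HasSurjectiveModNGaloisRep (3 ^ n : ℕ))
    (τ : absoluteGaloisGroup ℚ) (hτμ : τ ∈ rootsOfUnityFixer ℚ (3 ^ (k' + 1)))
    (hτq' : Nonempty (cokerSubOne (W.torsionGaloisModule (((3 : ℕ) : ℤ) ^ k' * ((3 : ℕ) : ℤ))) τ ≃+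
      ZMod (3 ^ (k' + 1))))
    (inv : LocalInvariants ℚ 3) (hperf : inv.IsPerfect) (hsum : inv.SumLocalTermEqZero)
    (hcompl : inv.SelmerComplement)
    (hEP : ∀ v : HeightOneSpectrum (𝓞 ℚ), localEulerPoincareCharacteristic (v.adicCompletion ℚ))
    (S : Finset (Place ℚ)) (hS : ∀ w : InfinitePlace ℚ, (Sum.inl w : Place ℚ) ∈ S)
    (h3S : ∀ v : HeightOneSpectrum (𝓞 ℚ), ((3 : ℕ) : 𝓞 ℚ) ∈ v.asIdeal → (Sum.inr v : Place ℚ) ∈ S)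
    (hbadS : ∀ v : HeightOneSpectrum (𝓞 ℚ), ¬ W.HasGoodReductionAt v → (Sum.inr v : Place ℚ) ∈ S)
    (D : KolyvaginDatum (W.torsionGaloisModule (((3 : ℕ) : ℤ) ^ k * ((3 : ℕ) : ℤ))))
    (η : (q : HeightOneSpectrum (𝓞 ℚ)) → (ZMod (Ideal.absNorm q.asIdeal))ˣ)
    (hP : D.primes = frobeniusClassPrimes (W.torsionGaloisModule (((3 : ℕ) : ℤ) ^ k' * ((3 : ℕ) : ℤ)))
      {v | (Sum.inr v : Place ℚ) ∈ S} τ (3 ^ (k' + 1)))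
    (hT : D.transverse = cyclotomicTransverse (W.torsionGaloisModule (((3 : ℕ) : ℤ) ^ k * ((3 : ℕ) : ℤ))))
    (hD : D.HasCanonicalComparison (3 ^ (k + 1)) η) :
    ∃ κ : D.kolyvaginSystems (propagatedSelmerStructure W 3 k),
      AddSubgroup.zmultiples κ = ⊤ ∧
      addOrderOf (κ.1 : Finset (HeightOneSpectrum (𝓞 ℚ)) →
        galoisCohomology (W.torsionGaloisModule (((3 : ℕ) : ℤ) ^ k * ((3 : ℕ) : ℤ))) 1) = 3 ^ (k + 1) ∧
      (∀ κ' ∈ D.kolyvaginSystems (propagatedSelmerStructure W 3 k), ∃ a : ℕ, κ' = a • κ.1) ∧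
      ∀ (inv' : LocalInvariants ℚ (3 ^ (k + 1))), inv'.IsPerfect → inv'.SumLocalTermEqZero →
        inv'.SelmerComplement →
        ∀ d, D.IsLevel d →
          (Nat.card (inv'.dualSelmerStructure _
              (D.atLevel (propagatedSelmerStructure W 3 k) d)).selmerGroup ∣ 3 ^ (k + 1) →
            addOrderOf (κ.1 d) * Nat.card (inv'.dualSelmerStructure _
              (D.atLevel (propagatedSelmerStructure W 3 k) d)).selmerGroup = 3 ^ (k + 1)) ∧
          (3 ^ (k + 1) ∣ Nat.card (inv'.dualSelmerStructure _
              (D.atLevel (propagatedSelmerStructure W 3 k) d)).selmerGroup → κ.1 d = 0) := by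
  haveI : Fact (Nat.Prime 3) := ⟨Nat.prime_three⟩
  have h3 : W.HasSurjectiveModNGaloisRep ((3 : ℕ) : ℤ) := by simpa using htower 1
  -- `τ` on `E[3]`
  have hτq₁ : Nonempty (cokerSubOne (W.torsionGaloisModule ((3 : ℕ) : ℤ)) τ ≃+ ZMod 3) := by
    have hl' : ((3 : ℕ) : ℤ) ^ (k' + 1) = ((3 : ℕ) : ℤ) ^ k' * ((3 : ℕ) : ℤ) := pow_succ _ _
    have h1 : Nonempty (cokerSubOne (W.torsionGaloisModule (((3 : ℕ) : ℤ) ^ (k' + 1))) τ ≃+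
        ZMod (3 ^ (k' + 1))) := by
      rw [hl']; exact hτq'
    have h := nonempty_cokerSubOne_equiv_zmod_pow_of_le W Nat.prime_three (Nat.succ_le_succ (Nat.zero_le k'))
      τ h1
    have hl : ((3 : ℕ) : ℤ) ^ (0 + 1) = ((3 : ℕ) : ℤ) := by rw [zero_add, pow_one]
    rw [hl] at h
    simpa using h
  -- a generator system `η′` everywhere (only its existence matters for the `E[3]`-datum)
  obtain ⟨η', -, hη', -⟩ := exists_eta_eq_on_primes_forall_zpowers_eq_top
    (W.torsionGaloisModule (((3 : ℕ) : ℤ) ^ k * ((3 : ℕ) : ℤ))) hD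
  -- the `E[3]`-datum on the deep class and its good core vertex (residual Kummer currency)
  obtain ⟨D₁, hP₁, hT₁, -⟩ := exists_deepDatum_torsion_three W k' {v | (Sum.inr v : Place ℚ) ∈ S}
    hτμ hτq₁ η' hη'
  haveI : Finite (W.kummerSelmerStructure ((3 : ℕ) : ℤ)).selmerGroup := by
    rw [← selmerGroup_eq_selmerGroup_kummerSelmerStructure]
    exact W.finite_selmerGroup_holds (by norm_num)
  obtain ⟨n₀, -, hn₀, hdual, -, -⟩ := exists_superset_kummerSelmerGroup_eq_bot_rat_three_deep W h3 k' τ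
    hτμ hτq₁ inv hperf hsum hcompl S hS h3S hbadS D₁ hP₁ hT₁ (KolyvaginDatum.isLevel_empty D₁)
  have hbot : (inv.dualSelmerStructure (W.torsionGaloisModule ((3 : ℕ) : ℤ))
      ((W.kummerSelmerStructure ((3 : ℕ) : ℤ)).transverseAt
        (cyclotomicTransverse (W.torsionGaloisModule ((3 : ℕ) : ℤ))) n₀)).selmerGroup = ⊥ := by
    have h := hdual
    change (inv.dualSelmerStructure _ ((W.kummerSelmerStructure ((3 : ℕ) : ℤ)).transverseAt
      D₁.transverse n₀)).selmerGroup = ⊥ at h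
    rwa [hT₁] at h
  have hn₀D : D.IsLevel n₀ := fun q hq => by
    rw [hP]
    exact hP₁ ▸ hn₀ hq
  exact exists_generator_kolyvaginSystems_deep_of_pinned W hS24 hS24₂ hk hkk' htower τ hτμ hτq' inv hperf hsum
    hcompl hEP S hS h3S hbadS D η hP hT hD hn₀D hbot

/-! ### §2 The shared-`η` deep family at every depth from the PINNED facts -/

/-- **The deep family with a SHARED generator `η`, from [S24] Thm. 4.4 (1)(2) AS PRINTED** — the drop-in for
gen 0's `KimAtThreeDeepLowerDeepPortWith.exists_deepFamily_of_towerSurj_with` (credit cell b2b-bsdres n1011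
`KolyvaginDeepFamily`): for a certificate depth `k ≥ 1` and a class shift `N`, ONE `τ` with its two all-level
properties, ONE Poitou–Tate family `inv` at `3`, Tate's `hEP`, `S ⊇ ∞ ∪ {3} ∪ {bad}`, the geometric torsion
finite at every depth, and ONE `η` generating every `(ℤ/N𝔮)ˣ`: at every depth `k′` a Kolyvagin datum `D k′` for
`E[3^{k′+1}]` and a Kolyvagin system `g k′` with — `(D k′).primes` = the class through `E[3^{c+1}]` at `3^{c+1}`,
`c = max k k′ + N` for `k′ ≥ 1` and `c = 0` (pinned) for `k′ = 0`; cyclotomic transverse conditions; THE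
canonical comparison maps at `3^{k′+1}` FOR `η`; `(D k′).primes ⊆ (D k).primes` for `k ≤ k′`; primes off `S`;
`#H¹_ur(ℚ_𝔮, E[3^{k′+1}]) = #𝒯_𝔮`; `g k′ ∈ KS₁` of additive order `3^{k′+1}`, ℕ-generating; [S24] (2) in ORDER
form at every level for every full-level Poitou–Tate family.  §1 at depths `k′ ≥ 1`, n1011's pinned
`TowerPackage.exists_generator_kolyvaginSystems_of_towerSurj` at depth `0`.  CONDITIONAL on `hS24 hS24₂` (PUB) only.
[cite: Sakamoto2024, Thm. 4.4 (1)(2) (p. 926)] [cite: MazurRubin2004, §3.5 (H.5) (p. 27) and Prop. A.2 (pp. 79–80)] -/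
theorem exists_deepFamily_of_pinned_with (W : WeierstrassCurve ℚ) [W.IsElliptic]
    (hS24 : Sakamoto2024.kolyvaginSystems_freeRankOne_zmod_three_pow)
    (hS24₂ : Sakamoto2024.kolyvaginSystems_idealOfBasis_eq_fittingIdeal_zmod_three_pow) (N k : ℕ) (hk : 1 ≤ k)
    (htower : ∀ n : ℕ, W.HasSurjectiveModNGaloisRep (3 ^ n : ℕ))
    (τ : absoluteGaloisGroup ℚ) (hτμ : ∀ n : ℕ, τ ∈ rootsOfUnityFixer ℚ (3 ^ n))
    (hτq : ∀ m : ℕ, Nonempty (cokerSubOne (W.torsionGaloisModule (((3 : ℕ) : ℤ) ^ m * ((3 : ℕ) : ℤ))) τ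
      ≃+ ZMod (3 ^ (m + 1))))
    (inv : LocalInvariants ℚ 3) (hperf : inv.IsPerfect) (hsum : inv.SumLocalTermEqZero)
    (hcompl : inv.SelmerComplement)
    (hEP : ∀ v : HeightOneSpectrum (𝓞 ℚ), localEulerPoincareCharacteristic (v.adicCompletion ℚ))
    (S : Finset (Place ℚ)) (hS : ∀ w : InfinitePlace ℚ, (Sum.inl w : Place ℚ) ∈ S)
    (h3S : ∀ v : HeightOneSpectrum (𝓞 ℚ), ((3 : ℕ) : 𝓞 ℚ) ∈ v.asIdeal → (Sum.inr v : Place ℚ) ∈ S)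
    (hbadS : ∀ v : HeightOneSpectrum (𝓞 ℚ), ¬ W.HasGoodReductionAt v → (Sum.inr v : Place ℚ) ∈ S)
    (hfinT : ∀ k' : ℕ, Finite (geomTorsion W (((3 : ℕ) : ℤ) ^ k' * ((3 : ℕ) : ℤ))))
    (η : (q : HeightOneSpectrum (𝓞 ℚ)) → (ZMod (Ideal.absNorm q.asIdeal))ˣ)
    (hη : ∀ q : HeightOneSpectrum (𝓞 ℚ), Subgroup.zpowers (η q) = ⊤) :
    ∃ (D : ∀ k' : ℕ, KolyvaginDatum (W.torsionGaloisModule (((3 : ℕ) : ℤ) ^ k' * ((3 : ℕ) : ℤ))))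
      (g : ∀ k' : ℕ, Finset (HeightOneSpectrum (𝓞 ℚ)) →
        galoisCohomology (W.torsionGaloisModule (((3 : ℕ) : ℤ) ^ k' * ((3 : ℕ) : ℤ))) 1),
      (∀ k', (D k').primes = frobeniusClassPrimes
          (W.torsionGaloisModule (((3 : ℕ) : ℤ) ^ (if k' = 0 then 0 else max k k' + N) * ((3 : ℕ) : ℤ)))
          {v | (Sum.inr v : Place ℚ) ∈ S} τ (3 ^ ((if k' = 0 then 0 else max k k' + N) + 1))) ∧
      (∀ k', (D k').transverse = cyclotomicTransverse _) ∧
      (∀ k', (D k').HasCanonicalComparison (3 ^ (k' + 1)) η) ∧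
      (∀ k', k ≤ k' → (D k').primes ⊆ (D k).primes) ∧
      (∀ k', ∀ q ∈ (D k').primes, (Sum.inr q : Place ℚ) ∉ S) ∧
      (∀ k', ∀ q ∈ (D k').primes,
        Nat.card (unramifiedSubgroup (GaloisRep.toLocal q
          (W.torsionGaloisModule (((3 : ℕ) : ℤ) ^ k' * ((3 : ℕ) : ℤ)))) 1) =
          Nat.card ((D k').transverse (Sum.inr q))) ∧
      (∀ k', g k' ∈ (D k').kolyvaginSystems (propagatedSelmerStructure W 3 k')) ∧
      (∀ k', addOrderOf (g k') = 3 ^ (k' + 1)) ∧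
      (∀ k', ∀ κ ∈ (D k').kolyvaginSystems (propagatedSelmerStructure W 3 k'), ∃ a : ℕ, κ = a • g k') ∧
      (∀ k' (inv' : LocalInvariants ℚ (3 ^ (k' + 1))), inv'.IsPerfect → inv'.SumLocalTermEqZero →
        inv'.SelmerComplement → ∀ d, (D k').IsLevel d →
          (Nat.card (inv'.dualSelmerStructure _
              ((D k').atLevel (propagatedSelmerStructure W 3 k') d)).selmerGroup ∣ 3 ^ (k' + 1) →
            addOrderOf (g k' d) * Nat.card (inv'.dualSelmerStructure _
              ((D k').atLevel (propagatedSelmerStructure W 3 k') d)).selmerGroup = 3 ^ (k' + 1)) ∧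
          (3 ^ (k' + 1) ∣ Nat.card (inv'.dualSelmerStructure _
              ((D k').atLevel (propagatedSelmerStructure W 3 k') d)).selmerGroup → g k' d = 0)) := by
  haveI : Fact (Nat.Prime 3) := ⟨Nat.prime_three⟩
  -- the class exponent of the member at depth `k′`
  have hle : ∀ k' : ℕ, k' ≤ (if k' = 0 then 0 else max k k' + N) := fun k' => by
    by_cases h0 : k' = 0
    · rw [if_pos h0, h0]
    · rw [if_neg h0]; exact (le_max_right k k').trans (Nat.le_add_right _ _)
  -- the datum at every depth, canonical for the SAME `η`
  have hdat := fun k' : ℕ => exists_kolyvaginDatum_torsion_pow_mul_deep_with W (hle k')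
    {v | (Sum.inr v : Place ℚ) ∈ S} (hτμ _) (hτq k') η hη
  choose D hP hT hD using hdat
  -- the generator at every depth: pinned at depth `0`, §1 at depths `≥ 1`
  have hgen : ∀ k' : ℕ, ∃ κ : (D k').kolyvaginSystems (propagatedSelmerStructure W 3 k'),
      AddSubgroup.zmultiples κ = ⊤ ∧
      addOrderOf (κ.1 : Finset (HeightOneSpectrum (𝓞 ℚ)) →
        galoisCohomology (W.torsionGaloisModule (((3 : ℕ) : ℤ) ^ k' * ((3 : ℕ) : ℤ))) 1) = 3 ^ (k' + 1) ∧
      (∀ κ' ∈ (D k').kolyvaginSystems (propagatedSelmerStructure W 3 k'), ∃ a : ℕ, κ' = a • κ.1) ∧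
      ∀ (inv' : LocalInvariants ℚ (3 ^ (k' + 1))), inv'.IsPerfect → inv'.SumLocalTermEqZero →
        inv'.SelmerComplement →
        ∀ d, (D k').IsLevel d →
          (Nat.card (inv'.dualSelmerStructure _
              ((D k').atLevel (propagatedSelmerStructure W 3 k') d)).selmerGroup ∣ 3 ^ (k' + 1) →
            addOrderOf (κ.1 d) * Nat.card (inv'.dualSelmerStructure _
              ((D k').atLevel (propagatedSelmerStructure W 3 k') d)).selmerGroup = 3 ^ (k' + 1)) ∧
          (3 ^ (k' + 1) ∣ Nat.card (inv'.dualSelmerStructure _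
              ((D k').atLevel (propagatedSelmerStructure W 3 k') d)).selmerGroup → κ.1 d = 0) := by
    intro k'
    haveI : Finite (geomTorsion W ((3 : ℕ) : ℤ)) := by
      simpa only [pow_zero, one_mul] using finite_geomTorsion_pow_mul W 3 0
    haveI := hfinT k'
    by_cases h0 : k' = 0
    · subst h0
      have hP0 := hP 0
      rw [if_pos rfl] at hP0
      exact TowerPackage.exists_generator_kolyvaginSystems_of_towerSurj W hS24 hS24₂ 0 htower τ (hτμ _)
        (hτq 0) inv hperf hsum hcompl hEP S hS h3S hbadS (D 0) η hP0 (hT 0) (hD 0)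
    · have hPk := hP k'
      rw [if_neg h0] at hPk
      haveI := hfinT (max k k' + N)
      exact exists_generator_kolyvaginSystems_deep_of_pinned_of_towerSurj hS24 hS24₂ W
        (Nat.one_le_iff_ne_zero.mpr h0) ((le_max_right k k').trans (Nat.le_add_right _ _)) htower τ (hτμ _)
        (hτq _) inv hperf hsum hcompl hEP S hS h3S hbadS (D k') η hPk (hT k') (hD k')
  choose κ hκ hgo hgen' hR22 using hgen
  have hk0 : k ≠ 0 := Nat.one_le_iff_ne_zero.mp hk
  refine ⟨D, fun k' => (κ k').1, hP, hT, hD, fun k' hkk' => ?_, fun k' => ?_, fun k' => ?_,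
    fun k' => (κ k').2, hgo, hgen', fun k' inv' hperf' hsum' hcompl' d hd =>
      hR22 k' inv' hperf' hsum' hcompl' d hd⟩
  · -- nesting above `k`: the class through `E[3^{k′+N+1}]` lies in the class through `E[3^{k+N+1}]`
    have hk'0 : k' ≠ 0 := fun h => hk0 (Nat.le_zero.mp (h ▸ hkk'))
    have hPk := hP k
    have hPk' := hP k'
    rw [if_neg hk0, max_self] at hPk
    rw [if_neg hk'0, max_eq_right hkk'] at hPk'
    exact primes_subset_torsion_pow_mul_deep W (Nat.add_le_add_right hkk' N) hPk hPk'
  · exact not_mem_of_primes_eq_deep _ _ _ (hP k')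
  · haveI := hfinT k'
    exact natCard_unramifiedSubgroup_eq_natCard_transverse_torsion_pow_mul_deep W (hle k') (hP k')
      (hT k') (hτμ _) (hτq k')

end Summit.BirchSwinnertonDyer.BirchSwinnertonDyer.Theorems.KimAtThreeDeepLowerDeepFamilyOfPinned

end
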